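import Mathlib.Probability.Moments.SubGaussian
import Mathlib.Analysis.SpecialFunctions.Trigonometric.Series
import Mathlib.Analysis.Convex.SpecificFunctions.Basic
import Mathlib.Logic.Function.DependsOn
import Literature.ComputerArithmetic.ConnollyHighamMary2021.ProbabilisticBounds
import HarnessLib

/-!
# Azuma–Hoeffding bounds for martingale transforms of mean-independent roundoffs
(Hallman–Ipsen 2023, §1.2 "Probabilistic model for sequences of roundoffs" and §1.3 Lemmas 2–3)

HONEST FRAMING (ENGINES group, unit `eng-quad-4`, kernels lane of the `certquad` engine — shared
numerical engines serving client cells; rigour lives in the verifiers; every published number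
belongs to a client cell's ledger, not to the engines group): this file is MODEL-form mathematics
from the literature, typed and PROVED; nothing here is new and nothing enters as a named fact.
It supplies the probabilistic engine used by every probabilistic rounding-error bound of
Hallman–Ipsen (general summation, §2.2; shifted summation, §3; compensated summation, §4.3; mixed
precision, §5): the Azuma–Hoeffding inequality for the martingales that roundoff sequences generate.

## Sources

* E. Hallman, I. C. F. Ipsen, *Precision-aware deterministic and probabilistic error bounds for
  floating point summation*, Numer. Math. 155 (2023) 83–119, doi 10.1007/s00211-023-01370-y,
  arXiv:2203.15928 — bib key `HallmanIpsen2023`. Read at the arXiv text; items are cited by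
  section and by the running number of that text: §1.2 eq. (model:second)
  `E(δ_k | δ_1, …, δ_{k−1}) = E(δ_k) = 0` ("zero-mean random variables that are mean independent";
  footnote: the conditioning includes ALL earlier roundoffs, also the non-descendants);
  §1.3 Definition 1 (martingale [Mitzenmacher–Upfal]), Lemma 2 (Azuma–Hoeffding inequality
  [Roch, *Modern discrete probability*]): `|Z_n − Z_1| ≤ (Σ_{k=2}^n c_k²)^{1/2} √(2 ln(2/δ))` with
  probability at least `1 − δ` when `|Z_k − Z_{k−1}| ≤ c_k`; Lemma 3 (relaxed Azuma–Hoeffding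
  inequality [Chung–Lu 2006]): the same with probability at least `1 − (δ + η)` when the increment
  bounds hold simultaneously with probability at least `1 − η`.
* `Literature.ComputerArithmetic.ConnollyHighamMary2021.ProbabilisticBounds` supplies the roundoff
  model `SRErrorModel μ u δ` (measurable errors, `|δ_k| ≤ u` everywhere, MEAN INDEPENDENCE in the
  functional form `E[g(δ_0,…,δ_{k−1}) δ_k] = 0` for bounded measurable `g`) — this is exactly
  Hallman–Ipsen's model (model:second) [cite: ConnollyHighamMary2021, §4.1; HallmanIpsen2023 §1.2
  names stochastic rounding [connolly2021stochastic] as a mode producing (model:second)]; its sister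
  file `MartingaleProductBound` carries out the Azuma step for CONSTANT coefficients `ρ_i = ±1`.
  Here the coefficients are PREDICTABLE (functions of the earlier roundoffs), which is what
  the summation martingales `Z_i = Σ_{j≤i} (s_j + f_j) δ_j` of Hallman–Ipsen need (`f_j` is a
  function of the roundoffs committed below node `j`).

## Contents (all in the model (model:second) = `SRErrorModel μ u δ` on a probability space)

* `IsPredictable δ a` — `a_k = G_k(δ_0, δ_1, …)` with `G_k` measurable and depending only on the
  coordinates `< k` (HI Def. 1: "`Z_k` is a function of `X_1, …, X_k`"); `transform a δ n =
  Σ_{k<n} a_k δ_k` — the martingale `Z` of increments `a_k δ_k` (HI §2.2: `Z_i = Σ_j (s_j+f_j)δ_j`);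
  `truncTransform a A δ n = Σ_{k<n} clip_{A_k}(a_k) δ_k` — the same with the coefficients clipped to
  `[−A_k, A_k]` (equal to `transform` wherever `|a_k| ≤ A_k`).
* `integral_rep_mul_eq_zero` — mean independence for functionals of the whole past:
  `E[G(δ) δ_k] = 0` for bounded measurable `G` depending on coordinates `< k`.
* `mgf_truncTransform_le` — the Azuma step: `E exp(t Z̃_n) ≤ exp(t² Σ_{k<n} c_k²/2)`, `c_k = A_k u`
  (chord inequality for `exp` on `[−c_k, c_k]`, mean independence, `cosh x ≤ exp(x²/2)`);
  `hasSubgaussianMGF_truncTransform`.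
* LEMMA 2 (Azuma–Hoeffding) in three forms: `measure_le_truncTransform_le` (one tail,
  `exp(−ε²/(2Σc_k²))`), `azumaHoeffding` (HI's form: `P(|Z_n| > (Σ c_k²)^{1/2} √(2 ln(2/p))) ≤ p`
  under the sure bounds `|a_k| ≤ A_k`), `azumaHoeffding_two_sided` (`2 exp(−ε²/(2Σc_k²))`).
* LEMMA 3 (relaxed Azuma–Hoeffding) in the PREDICTABLE-FAILURE form that Hallman–Ipsen's
  proofs use (the increment bound `|Z_i − Z_{i−1}| ≤ u(|s_i| + F_i)` can fail only through
  `|f_i| > F_i`, an event determined by the earlier roundoffs): `azumaHoeffding_relaxed` —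
  `P(|Z_n| > (Σ c_k²)^{1/2} √(2 ln(2/p))) ≤ P(∃ k < n, |a_k| > A_k) + p`, proved by clipping the
  coefficients (the clipped transform is a genuine bounded-increment martingale transform and agrees
  with `Z_n` off the failure event).

## Typing notes

* Probabilities are stated as `μ {ω | bound < |Z ω|} ≤ ENNReal.ofReal p` ("with probability at
  least `1 − p`, `|Z| ≤ bound`"), exactly as in `ConnollyHighamMary2021`.
* HI's Lemma 3 is quoted from [Chung–Lu 2006] for an ARBITRARY failure event of probability `η`; we
  prove the case of a predictable failure event (coefficient bounds), which is the case applied in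
  HI Lemma 11 / Theorems 12, 15, 18, 23, 25. No claim is made about the general formulation.
* No positivity of `u` is assumed (`u ≥ 0` follows from the model on a nonempty space); degenerate
  radii (`Σ c_k² = 0`, `p ≥ 2`) are covered by the statements as typed.
-/

open MeasureTheory ProbabilityTheory Finset Real
open scoped NNReal ENNReal

namespace Literature.ComputerArithmetic.HallmanIpsen2023

open Literature.ComputerArithmetic.ConnollyHighamMary2021 (SRErrorModel)

variable {Ω : Type*} [MeasurableSpace Ω] {μ : Measure Ω} {u : ℝ} {δ : ℕ → Ω → ℝ}
  {a : ℕ → Ω → ℝ} {A : ℕ → ℝ}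

/-! ### Clipping -/

/-- Clipping to the interval `[−c, c]`: `clip c t = max(−c, min(t, c))`. [folklore] -/
def clip (c t : ℝ) : ℝ := max (-c) (min t c)

/-- `|clip c t| ≤ c` for `c ≥ 0`. [folklore] -/
private theorem abs_clip_le {c : ℝ} (hc : 0 ≤ c) (t : ℝ) : |clip c t| ≤ c := by
  unfold clip
  rw [abs_le]
  exact ⟨le_max_left _ _, max_le (by linarith) (min_le_right _ _)⟩

/-- Clipping does nothing inside the interval. [folklore] -/
private theorem clip_eq_self {c t : ℝ} (h : |t| ≤ c) : clip c t = t := by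
  rw [abs_le] at h
  unfold clip
  rw [min_eq_left h.2, max_eq_right h.1]

/-- `clip c` is measurable. [folklore] -/
private theorem measurable_clip (c : ℝ) : Measurable (clip c) :=
  measurable_const.max (measurable_id.min measurable_const)

/-! ### Predictable coefficients and martingale transforms -/

/-- A sequence `a_0, a_1, …` of random variables is PREDICTABLE with respect to the roundoffs
`δ_0, δ_1, …` if each `a_k` is a (measurable) function of the EARLIER roundoffs only:
`a_k = G_k(δ)` with `G_k : (ℕ → ℝ) → ℝ` measurable and depending only on the coordinates `< k`.
This is the measurability clause of a martingale with respect to `δ_1, …, δ_n` ("`Z_k` is a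
function of `X_1, …, X_k`") for the martingales `Z_i = Σ_{j ≤ i} a_j δ_j` of increments `a_j δ_j`.
[cite: HallmanIpsen2023, §1.3, Definition "Martingale" (Def. 1 of the arXiv text), first item;
§2.2, proofs of Lemma 11 and Theorem 12 ("is a martingale with respect to `δ_1, …, δ_{k−1}`")] -/
def IsPredictable (δ a : ℕ → Ω → ℝ) : Prop :=
  ∀ k, ∃ G : (ℕ → ℝ) → ℝ, Measurable G ∧ DependsOn G (Set.Iio k) ∧ ∀ ω, a k ω = G (fun i => δ i ω)

/-- The MARTINGALE TRANSFORM `Z_n = Σ_{k<n} a_k δ_k` of the roundoffs by predictable coefficients —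
the shape of every error expression Hallman–Ipsen bound probabilistically
(`f_k = Σ_{j≺k} (s_j + f_j) δ_j`, `e_n = Σ_j (s_j + f_j) δ_j`).
[cite: HallmanIpsen2023, §2.2, proof of Theorem 12 (`Z_i ≡ Σ_{j=2}^i (s_j+f_j)δ_j`)] -/
def transform (a δ : ℕ → Ω → ℝ) (n : ℕ) (ω : Ω) : ℝ := ∑ k ∈ range n, a k ω * δ k ω

/-- The CLIPPED martingale transform `Z̃_n = Σ_{k<n} clip_{A_k}(a_k) δ_k`: the coefficients are
forced into `[−A_k, A_k]`, so that the increment bounds `|Z̃_k − Z̃_{k−1}| ≤ A_k u` hold surely;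
it agrees with `Z_n` wherever `|a_k| ≤ A_k` for all `k < n` (the device behind the relaxed
inequality).
[cite: HallmanIpsen2023, §1.3, Lemma 3 (relaxed Azuma–Hoeffding) as applied in §2.2] -/
def truncTransform (a : ℕ → Ω → ℝ) (A : ℕ → ℝ) (δ : ℕ → Ω → ℝ) (n : ℕ) (ω : Ω) : ℝ :=
  ∑ k ∈ range n, clip (A k) (a k ω) * δ k ω

omit [MeasurableSpace Ω] in
/-- `Z̃_{n+1} = Z̃_n + clip_{A_n}(a_n) δ_n`. [cite: HallmanIpsen2023, §1.3, Lemma 2 (increments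
`Z_k − Z_{k−1}`)] -/
theorem truncTransform_succ (a : ℕ → Ω → ℝ) (A : ℕ → ℝ) (δ : ℕ → Ω → ℝ) (n : ℕ) (ω : Ω) :
    truncTransform a A δ (n + 1) ω = truncTransform a A δ n ω + clip (A n) (a n ω) * δ n ω := by
  simp [truncTransform, sum_range_succ]

omit [MeasurableSpace Ω] in
/-- Off the failure event the clipped transform IS the transform: if `|a_k ω| ≤ A_k` for all `k < n`
then `Z̃_n ω = Z_n ω`. [cite: HallmanIpsen2023, §1.3, Lemma 3] -/
theorem truncTransform_eq_transform {n : ℕ} {ω : Ω} (h : ∀ k < n, |a k ω| ≤ A k) :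
    truncTransform a A δ n ω = transform a δ n ω := by
  unfold truncTransform transform
  exact sum_congr rfl (fun k hk => by rw [clip_eq_self (h k (mem_range.mp hk))])

/-! ### The model: measurability consequences and mean independence for functionals of the past -/

/-- In the roundoff model the whole error sequence `ω ↦ (δ_i ω)_i` is a measurable map into `ℕ → ℝ`.
[cite: HallmanIpsen2023, §1.2, eq. (model:second)] -/
theorem measurable_seq (h : SRErrorModel μ u δ) : Measurable (fun ω => fun i => δ i ω) :=
  measurable_pi_lambda _ (fun i => h.measurable i)

/-- A predictable coefficient is a random variable (measurable).
[cite: HallmanIpsen2023, §1.3, Definition "Martingale", first item] -/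
theorem IsPredictable.measurable (h : SRErrorModel μ u δ) (hP : IsPredictable δ a) (k : ℕ) :
    Measurable (a k) := by
  obtain ⟨G, hG, -, hGa⟩ := hP k
  have : a k = fun ω => G (fun i => δ i ω) := funext hGa
  rw [this]
  exact hG.comp (measurable_seq h)

omit [MeasurableSpace Ω] in
/-- Clipped predictable coefficients are predictable. [cite: HallmanIpsen2023, §1.3, Lemma 3] -/
theorem IsPredictable.clipped (hP : IsPredictable δ a) (A : ℕ → ℝ) :
    IsPredictable δ (fun k ω => clip (A k) (a k ω)) := by
  intro k
  obtain ⟨G, hG, hdep, hGa⟩ := hP k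
  refine ⟨fun v => clip (A k) (G v), (measurable_clip (A k)).comp hG, ?_, fun ω => ?_⟩
  · intro v w hvw
    show clip (A k) (G v) = clip (A k) (G w)
    rw [hdep hvw]
  · show clip (A k) (a k ω) = clip (A k) (G fun i => δ i ω)
    rw [hGa]

/-- The transforms are measurable. [cite: HallmanIpsen2023, §1.3, Definition "Martingale"] -/
theorem measurable_truncTransform (h : SRErrorModel μ u δ) (hP : IsPredictable δ a) (A : ℕ → ℝ)
    (n : ℕ) : Measurable (truncTransform a A δ n) := by
  unfold truncTransform
  refine Finset.measurable_sum _ (fun k _ => ?_)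
  exact ((measurable_clip (A k)).comp (hP.measurable h k)).mul (h.measurable k)

/-- `0 ≤ u` in the model, as soon as the space carries a probability measure.
[cite: HallmanIpsen2023, §1.2, eq. (model:classical) `|δ| ≤ u`] -/
theorem u_nonneg [IsProbabilityMeasure μ] (h : SRErrorModel μ u δ) : 0 ≤ u := by
  obtain ⟨ω⟩ := nonempty_of_isProbabilityMeasure μ
  exact (abs_nonneg _).trans (h.bounded 0 ω)

/-- Extension of a finite prefix `w : Fin k → ℝ` to a sequence (zero beyond `k`). [folklore] -/
def extendSeq (k : ℕ) (w : Fin k → ℝ) : ℕ → ℝ := fun i => if hi : i < k then w ⟨i, hi⟩ else 0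

/-- `extendSeq k` is measurable. [folklore] -/
private theorem measurable_extendSeq (k : ℕ) : Measurable (extendSeq k) := by
  refine measurable_pi_lambda _ (fun i => ?_)
  by_cases hi : i < k
  · simp only [extendSeq, hi, dite_true]
    exact measurable_pi_apply _
  · simp only [extendSeq, hi, dite_false]
    exact measurable_const

/-- **Mean independence for functionals of the past.** In the model (model:second), for every
bounded measurable functional `G` of the roundoff sequence that depends only on the roundoffs
`δ_i`, `i < k`: `E[G(δ) · δ_k] = 0`. (The model's clause is stated for functionals of the finite
prefix `(δ_0, …, δ_{k−1})`; this is the same statement for prefix-determined functionals of the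
whole sequence.)
[cite: HallmanIpsen2023, §1.2, eq. (model:second) `E(δ_k | δ_1,…,δ_{k−1}) = E(δ_k) = 0`] -/
theorem integral_rep_mul_eq_zero (h : SRErrorModel μ u δ) (k : ℕ) {G : (ℕ → ℝ) → ℝ}
    (hG : Measurable G) (hdep : DependsOn G (Set.Iio k)) (hbd : ∃ C, ∀ v, |G v| ≤ C) :
    ∫ ω, G (fun i => δ i ω) * δ k ω ∂μ = 0 := by
  set g : (Fin k → ℝ) → ℝ := fun w => G (extendSeq k w) with hg
  have hgm : Measurable g := hG.comp (measurable_extendSeq k)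
  have hgb : ∃ C, ∀ w, |g w| ≤ C := by
    obtain ⟨C, hC⟩ := hbd
    exact ⟨C, fun w => hC _⟩
  have key := h.meanIndep k g hgm hgb
  have hgδ : ∀ ω, g (fun i : Fin k => δ i ω) = G (fun i => δ i ω) := by
    intro ω
    rw [hg]
    refine hdep (fun i hi => ?_)
    simp only [Set.mem_Iio] at hi
    simp [extendSeq, hi]
  simp_rw [hgδ] at key
  exact key

/-! ### Realisation of the clipped transform as a functional of the roundoff sequence -/

section Rep

omit [MeasurableSpace Ω]

variable (hP : IsPredictable δ a) (A : ℕ → ℝ) (u : ℝ)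

/-- The clipped coefficient as a functional of the roundoff sequence: `v ↦ clip_{A_k}(G_k v)` for a
chosen measurable prefix-determined representative `G_k` of `a_k`. [folklore] -/
noncomputable def coefRep (k : ℕ) : (ℕ → ℝ) → ℝ := fun v => clip (A k) (Classical.choose (hP k) v)

/-- The clipped transform as a functional: `v ↦ Σ_{j<m} clip_{A_j}(G_j v) · clip_u(v_j)`.
[folklore] -/
noncomputable def transformRep (m : ℕ) : (ℕ → ℝ) → ℝ :=
  fun v => ∑ j ∈ range m, coefRep hP A j v * clip u (v j)

/-- [folklore] measurability of `coefRep`. -/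
private theorem measurable_coefRep (k : ℕ) : Measurable (coefRep hP A k) :=
  (measurable_clip (A k)).comp (Classical.choose_spec (hP k)).1

/-- [folklore] `coefRep k` depends only on the coordinates `< k`. -/
private theorem dependsOn_coefRep (k : ℕ) : DependsOn (coefRep hP A k) (Set.Iio k) := by
  intro v w hvw
  unfold coefRep
  rw [(Classical.choose_spec (hP k)).2.1 hvw]

/-- [folklore] `|coefRep k v| ≤ A_k`. -/
private theorem abs_coefRep_le {k : ℕ} (hA : 0 ≤ A k) (v : ℕ → ℝ) : |coefRep hP A k v| ≤ A k :=
  abs_clip_le hA _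

/-- [folklore] on the roundoff sequence, `coefRep k` evaluates to the clipped coefficient. -/
private theorem coefRep_apply (k : ℕ) (ω : Ω) :
    coefRep hP A k (fun i => δ i ω) = clip (A k) (a k ω) := by
  unfold coefRep
  rw [← (Classical.choose_spec (hP k)).2.2 ω]

/-- [folklore] measurability of `transformRep`. -/
private theorem measurable_transformRep (m : ℕ) : Measurable (transformRep hP A u m) := by
  unfold transformRep
  refine Finset.measurable_sum _ (fun j _ => ?_)
  exact (measurable_coefRep hP A j).mul ((measurable_clip u).comp (measurable_pi_apply j))

/-- [folklore] `transformRep m` depends only on the coordinates `< m`. -/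
private theorem dependsOn_transformRep (m : ℕ) : DependsOn (transformRep hP A u m) (Set.Iio m) := by
  intro v w hvw
  unfold transformRep
  refine sum_congr rfl (fun j hj => ?_)
  have hjm : j < m := mem_range.mp hj
  rw [dependsOn_coefRep hP A j (fun i hi => hvw i (lt_trans (Set.mem_Iio.mp hi) hjm)),
    hvw j (Set.mem_Iio.mpr hjm)]

/-- [folklore] the sure bound `|transformRep m v| ≤ Σ_{j<m} A_j u`. -/
private theorem abs_transformRep_le (hA : ∀ k, 0 ≤ A k) (hu : 0 ≤ u) (m : ℕ) (v : ℕ → ℝ) :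
    |transformRep hP A u m v| ≤ ∑ j ∈ range m, A j * u := by
  unfold transformRep
  refine (abs_sum_le_sum_abs _ _).trans (sum_le_sum (fun j _ => ?_))
  rw [abs_mul]
  exact mul_le_mul (abs_coefRep_le hP A (hA j) v) (abs_clip_le hu _) (abs_nonneg _) (hA j)

/-- [folklore] on the roundoff sequence, `transformRep m` evaluates to the clipped transform. -/
private theorem transformRep_apply (hδ : ∀ k ω, |δ k ω| ≤ u) (m : ℕ) (ω : Ω) :
    transformRep hP A u m (fun i => δ i ω) = truncTransform a A δ m ω := by
  unfold transformRep truncTransform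
  refine sum_congr rfl (fun j _ => ?_)
  rw [coefRep_apply, clip_eq_self (hδ j ω)]

end Rep

/-! ### Analytic plumbing -/

/-- Chord inequality for the convex exponential on `[−c, c]`: there is a slope `K` (depending on
`t, c` only) with `e^{tx} ≤ cosh(tc) + K x` for all `|x| ≤ c` (`K = sinh(tc)/c` for `c > 0`).
[folklore] -/
private theorem exists_exp_mul_le_cosh_add {c : ℝ} (hc : 0 ≤ c) (t : ℝ) :
    ∃ K : ℝ, ∀ x : ℝ, |x| ≤ c → exp (t * x) ≤ cosh (t * c) + K * x := by
  rcases hc.eq_or_lt with hc0 | hc0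
  · refine ⟨0, fun x hx => ?_⟩
    rw [← hc0] at hx
    have hx0 : x = 0 := abs_nonpos_iff.mp hx
    rw [hx0, ← hc0]
    simp
  · refine ⟨sinh (t * c) / c, fun x hx => ?_⟩
    have hab := abs_le.mp hx
    have ha : 0 ≤ (c - x) / (2 * c) := div_nonneg (by linarith) (by linarith)
    have hb : 0 ≤ (c + x) / (2 * c) := div_nonneg (by linarith) (by linarith)
    have hab1 : (c - x) / (2 * c) + (c + x) / (2 * c) = 1 := by
      field_simp; ring
    have key := convexOn_exp.2 (Set.mem_univ (-(t * c))) (Set.mem_univ (t * c)) ha hb hab1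
    simp only [smul_eq_mul] at key
    have h1 : (c - x) / (2 * c) * (-(t * c)) + (c + x) / (2 * c) * (t * c) = t * x := by
      field_simp; ring
    rw [h1] at key
    rw [Real.cosh_eq, Real.sinh_eq]
    calc exp (t * x) ≤ (c - x) / (2 * c) * exp (-(t * c)) + (c + x) / (2 * c) * exp (t * c) := key
      _ = (exp (t * c) + exp (-(t * c))) / 2 + (exp (t * c) - exp (-(t * c))) / 2 / c * x := by
        field_simp; ring

/-! ### The Azuma step -/

/-- [folklore] the clipped transform is surely bounded: `|Z̃_m| ≤ Σ_{j<m} A_j u`. -/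
private theorem abs_truncTransform_le (h : SRErrorModel μ u δ) (hA : ∀ k, 0 ≤ A k) (m : ℕ) (ω : Ω) :
    |truncTransform a A δ m ω| ≤ ∑ j ∈ range m, A j * u := by
  unfold truncTransform
  refine (abs_sum_le_sum_abs _ _).trans (sum_le_sum (fun j _ => ?_))
  rw [abs_mul]
  exact mul_le_mul (abs_clip_le (hA j) _) (h.bounded j ω) (abs_nonneg _) (hA j)

section Azuma

variable [IsProbabilityMeasure μ]

/-- [folklore] integrability of `exp(t Z̃_m)` on the probability space. -/
private theorem integrable_exp_truncTransform (h : SRErrorModel μ u δ) (hP : IsPredictable δ a)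
    (hA : ∀ k, 0 ≤ A k) (m : ℕ) (t : ℝ) :
    Integrable (fun ω => exp (t * truncTransform a A δ m ω)) μ := by
  refine Integrable.of_mem_Icc 0 (exp (|t| * ∑ j ∈ range m, A j * u))
    ((measurable_const.mul (measurable_truncTransform h hP A m)).exp.aemeasurable)
    (ae_of_all _ (fun ω => ⟨(exp_pos _).le, ?_⟩))
  refine Real.exp_le_exp.mpr ((le_abs_self _).trans ?_)
  rw [abs_mul]
  exact mul_le_mul_of_nonneg_left (abs_truncTransform_le h hA m ω) (abs_nonneg t)

/-- **Mean independence applied to the exponential functional of the past**: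
`E[exp(t Z̃_m) · clip_{A_m}(a_m) · δ_m] = 0`.
[cite: HallmanIpsen2023, §1.2, eq. (model:second); §1.3, Definition "Martingale", third item] -/
theorem integral_exp_truncTransform_mul_eq_zero (h : SRErrorModel μ u δ) (hP : IsPredictable δ a)
    (hA : ∀ k, 0 ≤ A k) (m : ℕ) (t : ℝ) :
    ∫ ω, exp (t * truncTransform a A δ m ω) * clip (A m) (a m ω) * δ m ω ∂μ = 0 := by
  have hu := u_nonneg h
  set G : (ℕ → ℝ) → ℝ := fun v => exp (t * transformRep hP A u m v) * coefRep hP A m v with hG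
  have hGm : Measurable G :=
    ((measurable_const.mul (measurable_transformRep hP A u m)).exp).mul (measurable_coefRep hP A m)
  have hGd : DependsOn G (Set.Iio m) := by
    intro v w hvw
    simp only [hG, dependsOn_transformRep hP A u m hvw, dependsOn_coefRep hP A m hvw]
  have hGb : ∃ C, ∀ v, |G v| ≤ C := by
    refine ⟨exp (|t| * ∑ j ∈ range m, A j * u) * A m, fun v => ?_⟩
    rw [hG]; dsimp only
    rw [abs_mul, abs_of_pos (exp_pos _)]
    refine mul_le_mul ?_ (abs_coefRep_le hP A (hA m) v) (abs_nonneg _) (exp_pos _).le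
    refine Real.exp_le_exp.mpr ((le_abs_self _).trans ?_)
    rw [abs_mul]
    exact mul_le_mul_of_nonneg_left (abs_transformRep_le hP A u hA hu m v) (abs_nonneg t)
  have key := integral_rep_mul_eq_zero h m hGm hGd hGb
  have hGδ : ∀ ω, G (fun i => δ i ω) = exp (t * truncTransform a A δ m ω) * clip (A m) (a m ω) := by
    intro ω
    rw [hG]; dsimp only
    rw [transformRep_apply hP A u h.bounded, coefRep_apply]
  simp_rw [hGδ] at key
  exact key

/-- **The Azuma step (moment generating function of a bounded-increment martingale transform).**
With `c_k = A_k u` the sure increment bounds of `Z̃`, `E exp(t Z̃_n) ≤ exp(t² Σ_{k<n} c_k² / 2)`.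
Proof (the standard one): `exp(t Z̃_{m+1}) = exp(t Z̃_m) exp(t c̃_m δ_m) ≤ exp(t Z̃_m)(cosh(t c_m) +
K c̃_m δ_m)` by convexity, the `K`-term integrates to `0` by mean independence, and
`cosh(t c_m) ≤ exp(t² c_m²/2)`.
[cite: HallmanIpsen2023, §1.3, Lemma 2 (Azuma–Hoeffding inequality), proof device] -/
theorem mgf_truncTransform_le (h : SRErrorModel μ u δ) (hP : IsPredictable δ a)
    (hA : ∀ k, 0 ≤ A k) : ∀ n : ℕ, ∀ t : ℝ, ∫ ω, exp (t * truncTransform a A δ n ω) ∂μ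
      ≤ exp ((∑ k ∈ range n, (A k * u) ^ 2) * t ^ 2 / 2) := by
  have hu := u_nonneg h
  intro n
  induction n with
  | zero => intro t; simp [truncTransform]
  | succ m ih =>
    intro t
    have hc : 0 ≤ A m * u := mul_nonneg (hA m) hu
    obtain ⟨K, hK⟩ := exists_exp_mul_le_cosh_add hc t
    have hinc : ∀ ω, |clip (A m) (a m ω) * δ m ω| ≤ A m * u := fun ω => by
      rw [abs_mul]
      exact mul_le_mul (abs_clip_le (hA m) _) (h.bounded m ω) (abs_nonneg _) (hA m)
    have iE := integrable_exp_truncTransform h hP hA m t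
    have iEd : Integrable
        (fun ω => exp (t * truncTransform a A δ m ω) * clip (A m) (a m ω) * δ m ω) μ := by
      have : Integrable (fun ω => exp (t * truncTransform a A δ m ω)
          * (clip (A m) (a m ω) * δ m ω)) μ := by
        refine iE.mul_bdd (c := A m * u) ?_ (ae_of_all _ (fun ω => ?_))
        · exact (((measurable_clip (A m)).comp (hP.measurable h m)).mul
            (h.measurable m)).aestronglyMeasurable
        · rw [Real.norm_eq_abs]; exact hinc ω
      refine this.congr (ae_of_all _ (fun ω => ?_))
      simp only [mul_assoc]
    have hsplit : ∀ ω, exp (t * truncTransform a A δ (m + 1) ω)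
        = exp (t * truncTransform a A δ m ω) * exp (t * (clip (A m) (a m ω) * δ m ω)) := by
      intro ω; rw [truncTransform_succ, mul_add, exp_add]
    simp_rw [hsplit]
    have iL : Integrable (fun ω => exp (t * truncTransform a A δ m ω)
        * exp (t * (clip (A m) (a m ω) * δ m ω))) μ := by
      refine iE.mul_bdd (c := exp (|t| * (A m * u))) ?_ (ae_of_all _ (fun ω => ?_))
      · exact ((measurable_const.mul (((measurable_clip (A m)).comp (hP.measurable h m)).mul
          (h.measurable m))).exp).aestronglyMeasurable
      · rw [Real.norm_eq_abs, abs_of_pos (exp_pos _)]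
        refine Real.exp_le_exp.mpr ((le_abs_self _).trans ?_)
        rw [abs_mul]
        exact mul_le_mul_of_nonneg_left (hinc ω) (abs_nonneg t)
    have hpt : ∀ ω, exp (t * truncTransform a A δ m ω) * exp (t * (clip (A m) (a m ω) * δ m ω))
        ≤ cosh (t * (A m * u)) * exp (t * truncTransform a A δ m ω)
          + K * (exp (t * truncTransform a A δ m ω) * clip (A m) (a m ω) * δ m ω) := by
      intro ω
      calc exp (t * truncTransform a A δ m ω) * exp (t * (clip (A m) (a m ω) * δ m ω))
          ≤ exp (t * truncTransform a A δ m ω)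
              * (cosh (t * (A m * u)) + K * (clip (A m) (a m ω) * δ m ω)) :=
            mul_le_mul_of_nonneg_left (hK _ (hinc ω)) (exp_pos _).le
        _ = _ := by ring
    have iR : Integrable (fun ω => cosh (t * (A m * u)) * exp (t * truncTransform a A δ m ω)
          + K * (exp (t * truncTransform a A δ m ω) * clip (A m) (a m ω) * δ m ω)) μ :=
      (iE.const_mul _).add (iEd.const_mul _)
    calc ∫ ω, exp (t * truncTransform a A δ m ω) * exp (t * (clip (A m) (a m ω) * δ m ω)) ∂μ
        ≤ ∫ ω, (cosh (t * (A m * u)) * exp (t * truncTransform a A δ m ω)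
          + K * (exp (t * truncTransform a A δ m ω) * clip (A m) (a m ω) * δ m ω)) ∂μ :=
          integral_mono iL iR hpt
      _ = cosh (t * (A m * u)) * ∫ ω, exp (t * truncTransform a A δ m ω) ∂μ
          + K * ∫ ω, exp (t * truncTransform a A δ m ω) * clip (A m) (a m ω) * δ m ω ∂μ := by
          rw [integral_add (iE.const_mul _) (iEd.const_mul _), integral_const_mul,
            integral_const_mul]
      _ = cosh (t * (A m * u)) * ∫ ω, exp (t * truncTransform a A δ m ω) ∂μ := by
          rw [integral_exp_truncTransform_mul_eq_zero h hP hA m t, mul_zero, add_zero]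
      _ ≤ cosh (t * (A m * u)) * exp ((∑ k ∈ range m, (A k * u) ^ 2) * t ^ 2 / 2) :=
          mul_le_mul_of_nonneg_left (ih t) (cosh_pos _).le
      _ ≤ exp ((t * (A m * u)) ^ 2 / 2) * exp ((∑ k ∈ range m, (A k * u) ^ 2) * t ^ 2 / 2) :=
          mul_le_mul_of_nonneg_right (cosh_le_exp_half_sq _) (exp_pos _).le
      _ = exp ((∑ k ∈ range (m + 1), (A k * u) ^ 2) * t ^ 2 / 2) := by
          rw [← exp_add, sum_range_succ]; ring_nf

/-- The clipped transform `Z̃_n` has SUB-GAUSSIAN moment generating function with variance proxy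
`Σ_{k<n} c_k²`, `c_k = A_k u`.
[cite: HallmanIpsen2023, §1.3, Lemma 2 (Azuma–Hoeffding inequality)] -/
theorem hasSubgaussianMGF_truncTransform (h : SRErrorModel μ u δ) (hP : IsPredictable δ a)
    (hA : ∀ k, 0 ≤ A k) (n : ℕ) :
    HasSubgaussianMGF (truncTransform a A δ n) ((∑ k ∈ range n, (A k * u) ^ 2).toNNReal) μ where
  integrable_exp_mul t := integrable_exp_truncTransform h hP hA n t
  mgf_le t := by
    unfold mgf
    rw [Real.coe_toNNReal _ (sum_nonneg (fun k _ => sq_nonneg _))]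
    exact mgf_truncTransform_le h hP hA n t

/-- ONE TAIL of the Azuma–Hoeffding inequality for the clipped transform: for `ε ≥ 0` and
`σ² = Σ_{k<n} c_k² > 0`, `P(Z̃_n ≥ ε) ≤ exp(−ε²/(2σ²))`.
[cite: HallmanIpsen2023, §1.3, Lemma 2 (Azuma–Hoeffding inequality)] -/
theorem measureReal_le_truncTransform_le (h : SRErrorModel μ u δ) (hP : IsPredictable δ a)
    (hA : ∀ k, 0 ≤ A k) (n : ℕ) {ε : ℝ} (hε : 0 ≤ ε) :
    μ.real {ω | ε ≤ truncTransform a A δ n ω}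
      ≤ exp (-ε ^ 2 / (2 * ∑ k ∈ range n, (A k * u) ^ 2)) := by
  have h1 := (hasSubgaussianMGF_truncTransform h hP hA n).measure_ge_le hε
  rwa [Real.coe_toNNReal _ (sum_nonneg (fun k _ => sq_nonneg _))] at h1

/-- The lower tail: `P(Z̃_n ≤ −ε) ≤ exp(−ε²/(2σ²))`.
[cite: HallmanIpsen2023, §1.3, Lemma 2 (Azuma–Hoeffding inequality)] -/
theorem measureReal_truncTransform_le_neg_le (h : SRErrorModel μ u δ) (hP : IsPredictable δ a)
    (hA : ∀ k, 0 ≤ A k) (n : ℕ) {ε : ℝ} (hε : 0 ≤ ε) :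
    μ.real {ω | ε ≤ -truncTransform a A δ n ω}
      ≤ exp (-ε ^ 2 / (2 * ∑ k ∈ range n, (A k * u) ^ 2)) := by
  have h1 := (hasSubgaussianMGF_truncTransform h hP hA n).neg.measure_ge_le hε
  rw [Real.coe_toNNReal _ (sum_nonneg (fun k _ => sq_nonneg _))] at h1
  exact h1

/-- TWO-SIDED Azuma–Hoeffding for the clipped transform: `P(|Z̃_n| ≥ ε) ≤ 2 exp(−ε²/(2 Σ c_k²))`.
[cite: HallmanIpsen2023, §1.3, Lemma 2 (Azuma–Hoeffding inequality)] -/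
theorem measureReal_le_abs_truncTransform_le (h : SRErrorModel μ u δ) (hP : IsPredictable δ a)
    (hA : ∀ k, 0 ≤ A k) (n : ℕ) {ε : ℝ} (hε : 0 ≤ ε) :
    μ.real {ω | ε ≤ |truncTransform a A δ n ω|}
      ≤ 2 * exp (-ε ^ 2 / (2 * ∑ k ∈ range n, (A k * u) ^ 2)) := by
  have hsub : {ω | ε ≤ |truncTransform a A δ n ω|}
      ⊆ {ω | ε ≤ truncTransform a A δ n ω} ∪ {ω | ε ≤ -truncTransform a A δ n ω} := by
    intro ω hω
    simp only [Set.mem_setOf_eq, Set.mem_union] at hω ⊢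
    rcases le_or_gt 0 (truncTransform a A δ n ω) with h0 | h0
    · left; rwa [abs_of_nonneg h0] at hω
    · right; rwa [abs_of_neg h0] at hω
  calc μ.real {ω | ε ≤ |truncTransform a A δ n ω|}
      ≤ μ.real ({ω | ε ≤ truncTransform a A δ n ω} ∪ {ω | ε ≤ -truncTransform a A δ n ω}) :=
        measureReal_mono hsub
    _ ≤ μ.real {ω | ε ≤ truncTransform a A δ n ω} + μ.real {ω | ε ≤ -truncTransform a A δ n ω} :=
        measureReal_union_le _ _
    _ ≤ exp (-ε ^ 2 / (2 * ∑ k ∈ range n, (A k * u) ^ 2))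
        + exp (-ε ^ 2 / (2 * ∑ k ∈ range n, (A k * u) ^ 2)) :=
        add_le_add (measureReal_le_truncTransform_le h hP hA n hε)
          (measureReal_truncTransform_le_neg_le h hP hA n hε)
    _ = 2 * exp (-ε ^ 2 / (2 * ∑ k ∈ range n, (A k * u) ^ 2)) := by ring

/-- The Azuma–Hoeffding RADIUS `(Σ_k c_k²)^{1/2} √(2 ln(2/p))` at failure probability `p`.
[cite: HallmanIpsen2023, §1.3, Lemma 2, eq. for `|Z_n − Z_1|`] -/
noncomputable def azumaRadius (σsq p : ℝ) : ℝ := Real.sqrt σsq * Real.sqrt (2 * Real.log (2 / p))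

/-- `0 ≤ azumaRadius σ² p`. [cite: HallmanIpsen2023, §1.3, Lemma 2] -/
theorem azumaRadius_nonneg (σsq p : ℝ) : 0 ≤ azumaRadius σsq p :=
  mul_nonneg (Real.sqrt_nonneg _) (Real.sqrt_nonneg _)

/-- **LEMMA 2 (Azuma–Hoeffding) for the clipped transform, in Hallman–Ipsen's form.** For every
`0 < p`: with probability at least `1 − p`, `|Z̃_n| ≤ (Σ_{k<n} c_k²)^{1/2} √(2 ln(2/p))`,
`c_k = A_k u`; i.e. `μ {ω | radius < |Z̃_n ω|} ≤ p`.
[cite: HallmanIpsen2023, §1.3, Lemma 2 (Azuma–Hoeffding inequality, Lem. 2 of the arXiv text)] -/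
theorem azumaHoeffding_trunc (h : SRErrorModel μ u δ) (hP : IsPredictable δ a) (hA : ∀ k, 0 ≤ A k)
    (n : ℕ) {p : ℝ} (hp : 0 < p) :
    μ {ω | azumaRadius (∑ k ∈ range n, (A k * u) ^ 2) p < |truncTransform a A δ n ω|}
      ≤ ENNReal.ofReal p := by
  set σsq := ∑ k ∈ range n, (A k * u) ^ 2 with hσ
  have hσ0 : 0 ≤ σsq := sum_nonneg (fun k _ => sq_nonneg _)
  -- the probability of any event is at most 1; dispose of `p ≥ 1` first
  by_cases hp1 : 1 ≤ p
  · calc μ {ω | azumaRadius σsq p < |truncTransform a A δ n ω|} ≤ 1 := prob_le_one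
      _ ≤ ENNReal.ofReal p := by
          rw [← ENNReal.ofReal_one]; exact ENNReal.ofReal_le_ofReal hp1
  rw [not_le] at hp1
  -- degenerate radius: `σ² = 0` forces `Z̃_n = 0` surely
  rcases hσ0.eq_or_lt with hσz | hσpos
  · have hzero : ∀ ω, truncTransform a A δ n ω = 0 := by
      intro ω
      have hterm : ∀ k ∈ range n, (A k * u) ^ 2 = 0 := by
        have := (sum_eq_zero_iff_of_nonneg (fun k _ => sq_nonneg (A k * u))).mp hσz.symm
        exact this
      unfold truncTransform
      refine sum_eq_zero (fun k hk => ?_)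
      have hAk : A k * u = 0 := pow_eq_zero_iff (n := 2) (by norm_num) |>.mp (hterm k hk)
      have hb : |clip (A k) (a k ω) * δ k ω| ≤ A k * u := by
        rw [abs_mul]
        exact mul_le_mul (abs_clip_le (hA k) _) (h.bounded k ω) (abs_nonneg _) (hA k)
      rw [hAk] at hb
      exact abs_nonpos_iff.mp hb
    have hempty : {ω | azumaRadius σsq p < |truncTransform a A δ n ω|} = ∅ := by
      ext ω
      simp only [Set.mem_setOf_eq, Set.mem_empty_iff_false, iff_false, not_lt, hzero, abs_zero]
      exact azumaRadius_nonneg _ _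
    rw [hempty, measure_empty]
    exact bot_le
  -- main case: Chernoff on both tails at `ε = radius`, `ε² / (2σ²) = ln(2/p)`
  have hlog : 0 ≤ Real.log (2 / p) := Real.log_nonneg (by rw [le_div_iff₀ hp]; linarith)
  have hε : 0 ≤ azumaRadius σsq p := azumaRadius_nonneg _ _
  have hεsq : (azumaRadius σsq p) ^ 2 / (2 * σsq) = Real.log (2 / p) := by
    unfold azumaRadius
    rw [mul_pow, Real.sq_sqrt hσ0, Real.sq_sqrt (by positivity)]
    field_simp
  have htail := measureReal_le_abs_truncTransform_le h hP hA n hε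
  rw [← hσ, show -(azumaRadius σsq p) ^ 2 / (2 * σsq) = -((azumaRadius σsq p) ^ 2 / (2 * σsq)) by
    ring, hεsq, Real.exp_neg, Real.exp_log (by positivity)] at htail
  have hp2 : 2 * (2 / p)⁻¹ = p := by field_simp
  rw [hp2] at htail
  have hstrict : {ω | azumaRadius σsq p < |truncTransform a A δ n ω|}
      ⊆ {ω | azumaRadius σsq p ≤ |truncTransform a A δ n ω|} := by
    intro ω hω
    simp only [Set.mem_setOf_eq] at hω ⊢
    exact le_of_lt hω
  calc μ {ω | azumaRadius σsq p < |truncTransform a A δ n ω|}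
      ≤ μ {ω | azumaRadius σsq p ≤ |truncTransform a A δ n ω|} := measure_mono hstrict
    _ = ENNReal.ofReal (μ.real {ω | azumaRadius σsq p ≤ |truncTransform a A δ n ω|}) :=
        (ofReal_measureReal).symm
    _ ≤ ENNReal.ofReal p := ENNReal.ofReal_le_ofReal htail

/-- **LEMMA 2 (Azuma–Hoeffding inequality) for martingale transforms of the roundoffs.** In the
model (model:second), let `Z_n = Σ_{k<n} a_k δ_k` with predictable coefficients satisfying the sure
bounds `|a_k| ≤ A_k`, so that the increments obey `|Z_k − Z_{k−1}| ≤ c_k := A_k u`. Then for every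
`0 < p`, with probability at least `1 − p`,
`|Z_n| ≤ (Σ_{k<n} c_k²)^{1/2} √(2 ln(2/p))`.
[cite: HallmanIpsen2023, §1.3, Lemma 2 (Azuma–Hoeffding inequality [Roch], Lem. 2 of the arXiv
text), eq. `|Z_n − Z_1| ≤ (Σ c_k²)^{1/2} √(2 ln(2/δ))`] -/
theorem azumaHoeffding (h : SRErrorModel μ u δ) (hP : IsPredictable δ a)
    (hbd : ∀ k ω, |a k ω| ≤ A k) (n : ℕ) {p : ℝ} (hp : 0 < p) :
    μ {ω | azumaRadius (∑ k ∈ range n, (A k * u) ^ 2) p < |transform a δ n ω|}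
      ≤ ENNReal.ofReal p := by
  have hA : ∀ k, 0 ≤ A k := fun k => by
    obtain ⟨ω⟩ := nonempty_of_isProbabilityMeasure μ
    exact (abs_nonneg _).trans (hbd k ω)
  have heq : ∀ ω, transform a δ n ω = truncTransform a A δ n ω :=
    fun ω => (truncTransform_eq_transform (fun k _ => hbd k ω)).symm
  simp_rw [heq]
  exact azumaHoeffding_trunc h hP hA n hp

/-- Two-sided tail form of LEMMA 2 for `Z_n` itself: under the sure bounds `|a_k| ≤ A_k`,
`P(|Z_n| ≥ ε) ≤ 2 exp(−ε²/(2 Σ_{k<n} c_k²))`, `c_k = A_k u`, for every `ε ≥ 0`.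
[cite: HallmanIpsen2023, §1.3, Lemma 2 (Azuma–Hoeffding inequality)] -/
theorem azumaHoeffding_two_sided (h : SRErrorModel μ u δ) (hP : IsPredictable δ a)
    (hbd : ∀ k ω, |a k ω| ≤ A k) (n : ℕ) {ε : ℝ} (hε : 0 ≤ ε) :
    μ.real {ω | ε ≤ |transform a δ n ω|}
      ≤ 2 * exp (-ε ^ 2 / (2 * ∑ k ∈ range n, (A k * u) ^ 2)) := by
  have hA : ∀ k, 0 ≤ A k := fun k => by
    obtain ⟨ω⟩ := nonempty_of_isProbabilityMeasure μ
    exact (abs_nonneg _).trans (hbd k ω)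
  have heq : ∀ ω, transform a δ n ω = truncTransform a A δ n ω :=
    fun ω => (truncTransform_eq_transform (fun k _ => hbd k ω)).symm
  simp_rw [heq]
  exact measureReal_le_abs_truncTransform_le h hP hA n hε

/-- **LEMMA 3 (relaxed Azuma–Hoeffding inequality), predictable-failure form.** In the model
(model:second), let `Z_n = Σ_{k<n} a_k δ_k` with predictable coefficients and let `A_k ≥ 0` be
CANDIDATE bounds (`c_k = A_k u`), which may fail. Then for every `0 < p`,
`P(|Z_n| > (Σ_{k<n} c_k²)^{1/2} √(2 ln(2/p))) ≤ P(∃ k < n, |a_k| > A_k) + p`: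
if the increment bounds hold simultaneously with probability at least `1 − η`, the Azuma–Hoeffding
bound holds with probability at least `1 − (p + η)`. (Proof: the clipped transform obeys the bounds
surely and coincides with `Z_n` off the failure event.)
[cite: HallmanIpsen2023, §1.3, Lemma 3 (relaxed Azuma–Hoeffding inequality [Chung–Lu 2006],
Lem. 3 of the arXiv text), as applied in §2.2 (proofs of Lemma 11 and Theorem 12)] -/
theorem azumaHoeffding_relaxed (h : SRErrorModel μ u δ) (hP : IsPredictable δ a)
    (hA : ∀ k, 0 ≤ A k) (n : ℕ) {p : ℝ} (hp : 0 < p) :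
    μ {ω | azumaRadius (∑ k ∈ range n, (A k * u) ^ 2) p < |transform a δ n ω|}
      ≤ μ {ω | ∃ k < n, A k < |a k ω|} + ENNReal.ofReal p := by
  have hsub : {ω | azumaRadius (∑ k ∈ range n, (A k * u) ^ 2) p < |transform a δ n ω|}
      ⊆ {ω | ∃ k < n, A k < |a k ω|}
        ∪ {ω | azumaRadius (∑ k ∈ range n, (A k * u) ^ 2) p < |truncTransform a A δ n ω|} := by
    intro ω hω
    simp only [Set.mem_setOf_eq, Set.mem_union] at hω ⊢
    by_cases hgood : ∀ k < n, |a k ω| ≤ A k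
    · right; rwa [truncTransform_eq_transform hgood]
    · left
      by_contra hcon
      exact hgood (fun k hk => not_lt.mp (fun hlt => hcon ⟨k, hk, hlt⟩))
  calc μ {ω | azumaRadius (∑ k ∈ range n, (A k * u) ^ 2) p < |transform a δ n ω|}
      ≤ μ ({ω | ∃ k < n, A k < |a k ω|}
        ∪ {ω | azumaRadius (∑ k ∈ range n, (A k * u) ^ 2) p < |truncTransform a A δ n ω|}) :=
        measure_mono hsub
    _ ≤ μ {ω | ∃ k < n, A k < |a k ω|}
        + μ {ω | azumaRadius (∑ k ∈ range n, (A k * u) ^ 2) p < |truncTransform a A δ n ω|} :=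
        measure_union_le _ _
    _ ≤ μ {ω | ∃ k < n, A k < |a k ω|} + ENNReal.ofReal p := by
        gcongr
        exact azumaHoeffding_trunc h hP hA n hp

end Azuma

end Literature.ComputerArithmetic.HallmanIpsen2023
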